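import Literature.Barriers.CriticalPhenomena.SupercriticalSAWSpaceFillingTuned
import Literature.Probability.RandomPlanarGeometry.CritPercSLEDimensionUpperBound
import Literature.Probability.RandomPlanarGeometry.CritPercSLESimplePathHolds
import Literature.Probability.RandomPlanarGeometry.SLEExistenceConverse
import Mathlib.MeasureTheory.Measure.Lebesgue.Complex
import Mathlib.MeasureTheory.Measure.Hausdorff
import Mathlib.Topology.MetricSpace.HausdorffDimension
import Mathlib.Analysis.Calculus.ContDiff.RCLike
import HarnessLib

/-!
# Barrier mechanism, tenth audit (part B): the SLE_{8/3} conjecture FORCES zero density of the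
# critical self-avoiding walk — the necessity clause of the density axis, proved

Barrier catalogue `Literature/Barriers/CriticalPhenomena/` (D-0021); companion of
`SupercriticalSAWSpaceFillingDensity` (tenth audit, 2026-08-16, refuter, "barrier-audit" gen 10,
of the mechanism file `…Proofs` of `SupercriticalSAWSpaceFilling` = Theorem 1 of
H. Duminil-Copin, G. Kozma, A. Yadin, *Supercritical self-avoiding walks are space-filling*,
Ann. IHP Probab. Stat. 50 (2014) 315–326, arXiv:1110.3074). Part A proved that right-continuity
at `x_c` of the supercritical density `θ(x)` (Problem 9 of the source) — equivalently flatness of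
the free-energy increment, equivalently exponential rarity of dense critical configurations —
implies ZERO DENSITY of the critical walk, and recorded in prose that zero density is NECESSARY
for the sub-problem `Literature.Probability.RandomPlanarGeometry.SAW.SAWScalingLimit`. This file
proves that necessity, for every Dobrushin domain and every endpoint approximation, from the SLE
theory of the tree:

* `tendsto_measure_density_of_convergesInLawToSLE` — if the polylines of random self-avoiding
  walks of `Ω_δ` (any finite laws `P δ`) converge in law, in the curve topology, to a chordal SLE_κ
  random curve with `0 < κ ≤ 4`, then `P δ [δ²|γ_δ| ≥ ρ] → 0` for every `ρ > 0`;
* `tendsto_law_density_of_sawScalingLimit` — under `SAWScalingLimit`,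
  `P_{(Ω_δ,a_δ,b_δ,x_c)}[δ²|γ_δ| ≥ ρ] → 0` in every Dobrushin domain (`κ = 8/3`); the unit-disc
  instance `tendsto_lawAt_density_unitDisc_of_sawScalingLimit` is conclusion (Z) of part A;
* the closed `Prop` `SupercriticalSAWSpaceFillingDensityNecessary` with `…_holds`.

## Proof

1. **Lattice side** (`card_mul_sq_le_volume_ctube`): the open axis-parallel squares of side `δ`
   centred at the `|γ_δ| + 1` (distinct) sites of the walk are pairwise disjoint, have area `δ²`
   each (`volume_meshSquare`, through `Complex.measurableEquivRealProd`) and lie in the closed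
   `δ`-tube of the polyline (the sites are on it, `meshPoint_mem_range_curve`), so
   `(|γ_δ|+1) δ² ≤ vol{w : dist(w, trace γ_δ) ≤ δ}`.
2. **Topology** (`upperSemicontinuous_volume_ctube`, `isClosed_setOf_le_volume_ctube`,
   `tendsto_volume_ctube_nat`): on curve classes the closed-tube volume
   `c ↦ vol{w : dist(w, trace c) ≤ η}` is upper semicontinuous (the tube is the decreasing
   intersection of the tubes of radii `η + 1/(n+1)`, which contain the `η`-tube of every nearby
   class, `lipschitzWith_infDist_range`), so `{c : vol ≥ M}` is closed; and as `η ↓ 0` the tube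
   volume decreases to `vol(trace c)` (compact trace).
3. **Portmanteau, quantitative closed-set half** (`eventually_measure_mem_le_add`): if
   `Y δ → Z` in law (bounded continuous test functions, finite laws) and `F` is closed, then for
   every `ε > 0` eventually `P δ [Y δ ∈ F] ≤ W[Z ∈ F] + ε` — with the Lipschitz approximants
   `g_k = max(0, 1 - (k+1) dist(·, F)) ↓ 1_F` (`nearIndicator`) [Billingsley 1999, Thm 2.1].
4. **SLE side** (`ae_volume_range_eq_zero_of_isSLECurve`): the range of a chordal SLE_κ random
   curve, `0 < κ ≤ 4`, has zero area a.s.: it is contained in `φ(γ[0,∞) ∩ ℍ) ∪ {Φ(γ(0)), b}`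
   because the half-plane trace is simple with `Im γ(t) > 0` for `t > 0`
   (`ae_isSimpleTrace_sleTrace_of_le_four_holds`, Rohde–Schramm Thm 6.1, proved in the tree);
   `dim_H γ[0,∞) ≤ 1 + κ/8 < 2` (`ae_dimH_range_sleTrace_le`, Rohde–Schramm Thm 8.1 / Cor. 8.2,
   proved in the tree from the one-point estimate, the trace existing by `IsSLECurve.hasSLETrace`);
   the uniformizing map is holomorphic on `ℍ`, hence locally Lipschitz and dimension
   non-increasing (`volume_image_eq_zero_of_differentiableOn`); and sets of dimension `< 2` in
   `ℂ` are Lebesgue-null (`volume_eq_zero_of_dimH_lt_two`, through `μH[2] = volume` on `ℝ × ℝ`).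
5. **Assembly**: with `M = ρ`, the events `{M ≤ vol(1/(n+1)-tube of Γ)}` decrease to a subset of
   `{vol(trace Γ) > 0}`, a null set, so one of them has probability `< ε/2`; for `δ < 1/(n+1)`
   the density event `{δ²|γ_δ| ≥ ρ}` lies in `{γ_δ.curve ∈ F}` for the corresponding closed
   `F`, and step 3 bounds its probability by `ε/2 + ε/2` eventually.

No new hypothesis; axioms `propext`, `Classical.choice`, `Quot.sound`.

Mathlib: `dimH_image_le_of_locally_lipschitzOn`, `LipschitzWith.dimH_image_le`,
`hausdorffMeasure_of_dimH_lt`, `MeasureTheory.hausdorffMeasure_prod_real`,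
`Complex.volume_preserving_equiv_real_prod`, `ContDiffAt.exists_lipschitzOnWith`,
`DifferentiableOn.contDiffOn`, `Set.Finite.dimH_zero`, `tendsto_measure_iInter_atTop`,
`upperSemicontinuous_iff_isClosed_preimage`, `measure_biUnion_finset`, `Measure.prod_prod`,
`Real.volume_Ioo`, `ENNReal.tendsto_nhds_zero`, `AEMeasurable.nullMeasurableSet_preimage`.

## References

* H. Duminil-Copin, G. Kozma, A. Yadin, Ann. IHP Probab. Stat. 50 (2014) 315–326,
  arXiv:1110.3074, p. 8 (§4: Problem 9, the density `θ(x)`; Problem 10). [DuminilCopinKozmaYadin2014]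
* G. F. Lawler, O. Schramm, W. Werner, *On the scaling limit of planar self-avoiding walk* (2004),
  arXiv:math/0204277, §3.4.2 and Prediction 1 (§4.1) (the SLE_{8/3} conjecture); Prediction 2
  (`ν = 3/4`, `|γ_δ| ≍ δ^{-4/3}`, in particular zero density). [LawlerSchrammWerner2004SAW]
* S. Rohde, O. Schramm, *Basic properties of SLE*, Ann. Math. 161 (2005): Thm 6.1 (simple trace in
  `ℍ ∪ {0}` for `κ ≤ 4`), Thm 8.1 / Cor. 8.2 (`dim_H ≤ 1 + κ/8`). [RohdeSchramm2005]
* P. Billingsley, *Convergence of probability measures*, 2nd ed. (1999), Thm 2.1. [Billingsley1999]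
-/

noncomputable section

open MeasureTheory Filter Topology Metric Set Literature.Probability.LatticeModels
  Literature.Probability.Percolation Literature.Probability.RandomPlanarGeometry
  Literature.Probability.RandomPlanarGeometry.SAW
open scoped ENNReal NNReal BoundedContinuousFunction

namespace Literature.Barriers.CriticalPhenomena

namespace SupercriticalSAW

/-! ### Sets of Hausdorff dimension `< 2` in `ℂ` are Lebesgue-null -/

section DimH

/-- `z ↦ (re z, im z)` is `1`-Lipschitz from `ℂ` to `ℝ × ℝ` (sup distance). [folklore] -/
theorem lipschitzWith_reIm : LipschitzWith 1 fun z : ℂ => (z.re, z.im) := by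
  refine LipschitzWith.of_dist_le_mul fun z w => ?_
  rw [NNReal.coe_one, one_mul, Prod.dist_eq, Real.dist_eq, Real.dist_eq, Complex.dist_eq]
  refine max_le ?_ ?_
  · simpa using Complex.abs_re_le_norm (z - w)
  · simpa using Complex.abs_im_le_norm (z - w)

/-- **A subset of `ℂ` of Hausdorff dimension `< 2` has Lebesgue measure zero** (transfer to
`ℝ × ℝ`, where `μH[2] = volume`, by the Lipschitz map `z ↦ (re z, im z)`). [folklore] -/
theorem volume_eq_zero_of_dimH_lt_two {S : Set ℂ} (h : dimH S < 2) : volume S = 0 := by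
  set e := Complex.measurableEquivRealProd with he
  have hfun : (fun z : ℂ => (z.re, z.im)) = e := by
    funext z; rw [he, Complex.measurableEquivRealProd_apply]
  have hdim : dimH (e '' S) < 2 := by
    have h1 := lipschitzWith_reIm.dimH_image_le S
    rw [hfun] at h1
    exact h1.trans_lt h
  have hdim' : dimH (e '' S) < ((2 : ℝ≥0) : ℝ≥0∞) := by exact_mod_cast hdim
  have hH0 : μH[((2 : ℝ≥0) : ℝ)] (e '' S) = 0 := hausdorffMeasure_of_dimH_lt hdim'
  have h2 : ((2 : ℝ≥0) : ℝ) = 2 := by norm_num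
  rw [h2] at hH0
  have hH : (volume : Measure (ℝ × ℝ)) (e '' S) = 0 := by
    rw [← MeasureTheory.hausdorffMeasure_prod_real]; exact hH0
  have hpre : volume (e ⁻¹' (e '' S)) = volume (e '' S) :=
    Complex.volume_preserving_equiv_real_prod.measure_preimage (NullMeasurableSet.of_null hH)
  refine le_antisymm ?_ bot_le
  calc volume S ≤ volume (e ⁻¹' (e '' S)) := measure_mono (subset_preimage_image _ _)
    _ = 0 := by rw [hpre, hH]

end DimH

/-! ### The volume of the closed tube is upper semicontinuous on curve classes -/

section CTube

/-- The closed `η`-tube of a curve class is contained in a closed ball around any point of a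
closed ball containing the trace. [folklore] -/
theorem setOf_infDist_le_subset_closedBall (c : CurveClass ℂ) {x₀ : ℂ} {r : ℝ}
    (hr : c.range ⊆ closedBall x₀ r) (η : ℝ) :
    {w : ℂ | infDist w c.range ≤ η} ⊆ closedBall x₀ (η + r) := by
  intro w hw
  rw [mem_setOf_eq] at hw
  obtain ⟨y, hy, hdist⟩ := c.isCompact_range.exists_infDist_eq_dist c.range_nonempty w
  rw [mem_closedBall]
  have h1 : dist w y ≤ η := by rw [← hdist]; exact hw
  have h2 : dist y x₀ ≤ r := mem_closedBall.1 (hr hy)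
  linarith [dist_triangle w y x₀]

/-- The closed tube has finite volume. [folklore] -/
theorem volume_setOf_infDist_le_lt_top (c : CurveClass ℂ) (η : ℝ) :
    volume {w : ℂ | infDist w c.range ≤ η} < ⊤ := by
  obtain ⟨r, hr⟩ := c.isCompact_range.isBounded.subset_closedBall c.source
  exact (measure_mono (setOf_infDist_le_subset_closedBall c hr η)).trans_lt measure_closedBall_lt_top

/-- **Upper semicontinuity of the closed-tube volume.** The functional
`c ↦ vol{w : dist(w, trace c) ≤ η}` on curve classes is upper semicontinuous: the closed tube is
the decreasing intersection of the tubes of radii `η + 1/(n+1)`, each of which contains the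
`η`-tube of every curve class at distance `< 1/(n+1)`. [folklore] -/
theorem upperSemicontinuous_volume_ctube (η : ℝ) :
    UpperSemicontinuous fun c : CurveClass ℂ => volume {w : ℂ | infDist w c.range ≤ η} := by
  intro c y hy
  set A : ℕ → Set ℂ := fun n => {w | infDist w c.range ≤ η + 1 / ((n : ℝ) + 1)} with hA
  have hanti : Antitone A := by
    intro m n hmn w hw
    simp only [hA, mem_setOf_eq] at hw ⊢
    have : (1 : ℝ) / ((n : ℝ) + 1) ≤ 1 / ((m : ℝ) + 1) :=
      one_div_le_one_div_of_le (by positivity) (by exact_mod_cast Nat.succ_le_succ hmn)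
    linarith
  have hI : {w : ℂ | infDist w c.range ≤ η} = ⋂ n, A n := by
    ext w
    simp only [mem_setOf_eq, mem_iInter, hA]
    constructor
    · intro hw n
      have : (0 : ℝ) < 1 / ((n : ℝ) + 1) := by positivity
      linarith
    · intro hw
      refine le_of_forall_pos_lt_add fun ε hε => ?_
      obtain ⟨n, hn⟩ := exists_nat_one_div_lt hε
      linarith [hw n]
  have hmeas : ∀ n, NullMeasurableSet (A n) volume := fun n =>
    (isClosed_le (continuous_infDist_pt _) continuous_const).measurableSet.nullMeasurableSet
  have hfin : ∃ n, volume (A n) ≠ ⊤ := ⟨0, (volume_setOf_infDist_le_lt_top c _).ne⟩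
  have hlim : Tendsto (fun n => volume (A n)) atTop (𝓝 (volume (⋂ n, A n))) :=
    tendsto_measure_iInter_atTop hmeas hanti hfin
  rw [← hI] at hlim
  obtain ⟨n, hn⟩ := (hlim.eventually (Iio_mem_nhds hy)).exists
  have hpos : (0 : ℝ) < 1 / ((n : ℝ) + 1) := by positivity
  filter_upwards [Metric.ball_mem_nhds c hpos] with c' hc'
  refine lt_of_le_of_lt (measure_mono fun w hw => ?_) hn
  simp only [hA, mem_setOf_eq] at hw ⊢
  have hL := (lipschitzWith_infDist_range w).dist_le_mul c' c
  rw [NNReal.coe_one, one_mul, Real.dist_eq] at hL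
  rw [mem_ball] at hc'
  have := (abs_le.1 hL).1
  linarith

/-- The curve classes whose closed `η`-tube has volume `≥ M` form a closed set. [folklore] -/
theorem isClosed_setOf_le_volume_ctube (η : ℝ) (M : ℝ≥0∞) :
    IsClosed {c : CurveClass ℂ | M ≤ volume {w : ℂ | infDist w c.range ≤ η}} :=
  (upperSemicontinuous_iff_isClosed_preimage.1 (upperSemicontinuous_volume_ctube η)) M

/-- As `η ↓ 0` the closed-tube volume decreases to the volume of the (compact) trace. [folklore] -/
theorem tendsto_volume_ctube_nat (c : CurveClass ℂ) :
    Tendsto (fun n : ℕ => volume {w : ℂ | infDist w c.range ≤ 1 / ((n : ℝ) + 1)}) atTop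
      (𝓝 (volume c.range)) := by
  set A : ℕ → Set ℂ := fun n => {w | infDist w c.range ≤ 1 / ((n : ℝ) + 1)} with hA
  have hanti : Antitone A := by
    intro m n hmn w hw
    simp only [hA, mem_setOf_eq] at hw ⊢
    have : (1 : ℝ) / ((n : ℝ) + 1) ≤ 1 / ((m : ℝ) + 1) :=
      one_div_le_one_div_of_le (by positivity) (by exact_mod_cast Nat.succ_le_succ hmn)
    linarith
  have hI : c.range = ⋂ n, A n := by
    ext w
    simp only [mem_iInter, hA, mem_setOf_eq]
    constructor
    · intro hw n
      rw [infDist_zero_of_mem hw]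
      positivity
    · intro hw
      have h0 : infDist w c.range = 0 := by
        refine le_antisymm (le_of_forall_pos_lt_add fun ε hε => ?_) infDist_nonneg
        obtain ⟨n, hn⟩ := exists_nat_one_div_lt hε
        linarith [hw n]
      exact (c.isCompact_range.isClosed.mem_iff_infDist_zero c.range_nonempty).2 h0
  have hmeas : ∀ n, NullMeasurableSet (A n) volume := fun n =>
    (isClosed_le (continuous_infDist_pt _) continuous_const).measurableSet.nullMeasurableSet
  have hfin : ∃ n, volume (A n) ≠ ⊤ := ⟨0, (volume_setOf_infDist_le_lt_top c _).ne⟩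
  have := tendsto_measure_iInter_atTop hmeas hanti hfin
  rwa [← hI] at this

end CTube

/-! ### A quantitative closed-set portmanteau inequality along `δ → 0⁺` -/

section Portmanteau

variable {X : Type*} [MetricSpace X]

/-- The approximants `g_k(c) = max 0 (1 - (k+1) dist(c, F))` of the indicator of a closed set:
bounded continuous, values in `[0, 1]`, `= 1` on `F`, `= 0` at distance `≥ 1/(k+1)` from `F`.
[cite: Billingsley1999, Thm 2.1] -/
def nearIndicator (F : Set X) (k : ℕ) : X →ᵇ ℝ :=
  BoundedContinuousFunction.mkOfBound
    ⟨fun c => max 0 (1 - ((k : ℝ) + 1) * infDist c F),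
      continuous_const.max (continuous_const.sub (continuous_const.mul (continuous_infDist_pt F)))⟩
    1 fun c₁ c₂ => by
      simp only [ContinuousMap.coe_mk, Real.dist_eq]
      have h₁ : 0 ≤ max 0 (1 - ((k : ℝ) + 1) * infDist c₁ F) := le_max_left _ _
      have h₂ : max 0 (1 - ((k : ℝ) + 1) * infDist c₁ F) ≤ 1 :=
        max_le zero_le_one (by nlinarith [infDist_nonneg (x := c₁) (s := F)])
      have h₃ : 0 ≤ max 0 (1 - ((k : ℝ) + 1) * infDist c₂ F) := le_max_left _ _
      have h₄ : max 0 (1 - ((k : ℝ) + 1) * infDist c₂ F) ≤ 1 :=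
        max_le zero_le_one (by nlinarith [infDist_nonneg (x := c₂) (s := F)])
      rw [abs_le]; constructor <;> linarith

/-- Value of the approximant. [folklore] -/
theorem nearIndicator_apply (F : Set X) (k : ℕ) (c : X) :
    nearIndicator F k c = max 0 (1 - ((k : ℝ) + 1) * infDist c F) := rfl

/-- `0 ≤ g_k`. [folklore] -/
theorem nearIndicator_nonneg (F : Set X) (k : ℕ) (c : X) : 0 ≤ nearIndicator F k c := by
  rw [nearIndicator_apply]; exact le_max_left _ _

/-- `g_k ≤ 1`. [folklore] -/
theorem nearIndicator_le_one (F : Set X) (k : ℕ) (c : X) : nearIndicator F k c ≤ 1 := by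
  rw [nearIndicator_apply]
  exact max_le zero_le_one (by nlinarith [infDist_nonneg (x := c) (s := F)])

/-- `g_k = 1` on `F`. [folklore] -/
theorem nearIndicator_eq_one_of_mem {F : Set X} (k : ℕ) {c : X} (hc : c ∈ F) :
    nearIndicator F k c = 1 := by
  rw [nearIndicator_apply, infDist_zero_of_mem hc, mul_zero, sub_zero, max_eq_right zero_le_one]

/-- `g_k = 0` at distance `≥ 1/(k+1)` from `F`. [folklore] -/
theorem nearIndicator_eq_zero_of_le {F : Set X} {k : ℕ} {c : X}
    (hc : 1 / ((k : ℝ) + 1) ≤ infDist c F) : nearIndicator F k c = 0 := by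
  rw [nearIndicator_apply]
  refine max_eq_left ?_
  have hk : (0 : ℝ) < (k : ℝ) + 1 := by positivity
  have : 1 ≤ ((k : ℝ) + 1) * infDist c F := by
    rw [div_le_iff₀' hk] at hc
    exact hc
  linarith

variable [MeasurableSpace X] [OpensMeasurableSpace X]

/-- `P[Y ∈ F] ≤ ∫ g_k(Y) dP` for a finite measure and measurable `Y`. [folklore] -/
theorem measureReal_mem_le_integral_nearIndicator {Ω' : Type*} [MeasurableSpace Ω']
    (μ : Measure Ω') [IsFiniteMeasure μ] {Y₀ : Ω' → X} (hY : Measurable Y₀) {F : Set X}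
    (hF : IsClosed F) (k : ℕ) :
    (μ {a | Y₀ a ∈ F}).toReal ≤ ∫ a, nearIndicator F k (Y₀ a) ∂μ := by
  set S : Set Ω' := {a | Y₀ a ∈ F}
  have hS : MeasurableSet S := hY hF.measurableSet
  rw [← measureReal_def, ← integral_indicator_one hS]
  refine integral_mono ((integrable_const (1 : ℝ)).indicator hS) ?_ fun a => ?_
  · exact Integrable.of_bound
      ((nearIndicator F k).continuous.measurable.comp hY).aestronglyMeasurable 1
      (ae_of_all _ fun a => by
        rw [Real.norm_eq_abs, abs_of_nonneg (nearIndicator_nonneg _ _ _)]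
        exact nearIndicator_le_one _ _ _)
  · by_cases ha : a ∈ S
    · rw [indicator_of_mem ha, Pi.one_apply, nearIndicator_eq_one_of_mem k (show Y₀ a ∈ F from ha)]
    · rw [indicator_of_notMem ha]
      exact nearIndicator_nonneg _ _ _

/-- `∫ g_k(Z) dW ≤ W[dist(Z, F) < 1/(k+1)]` for a finite measure and a.e.-measurable `Z`.
[folklore] -/
theorem integral_nearIndicator_le_measureReal {Ω' : Type*} [MeasurableSpace Ω']
    (μ : Measure Ω') [IsFiniteMeasure μ] {Z : Ω' → X} (hZ : AEMeasurable Z μ) (F : Set X)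
    (k : ℕ) :
    ∫ a, nearIndicator F k (Z a) ∂μ ≤ (μ {a | infDist (Z a) F < 1 / ((k : ℝ) + 1)}).toReal := by
  set T : Set X := {x | infDist x F < 1 / ((k : ℝ) + 1)} with hT
  have hTo : IsOpen T := isOpen_lt (continuous_infDist_pt F) continuous_const
  -- replace `Z` by a measurable modification
  have hae : Z =ᵐ[μ] hZ.mk Z := hZ.ae_eq_mk
  have hE : (Z ⁻¹' T : Set Ω') =ᵐ[μ] (hZ.mk Z ⁻¹' T : Set Ω') := by
    filter_upwards [hae] with a ha
    show (a ∈ Z ⁻¹' T) = (a ∈ hZ.mk Z ⁻¹' T)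
    rw [mem_preimage, mem_preimage, ha]
  have hE' : MeasurableSet (hZ.mk Z ⁻¹' T) := hZ.measurable_mk hTo.measurableSet
  have h1 : ∫ a, nearIndicator F k (Z a) ∂μ = ∫ a, nearIndicator F k (hZ.mk Z a) ∂μ := by
    refine integral_congr_ae ?_
    filter_upwards [hae] with a ha
    rw [ha]
  have h2 : (μ {a | infDist (Z a) F < 1 / ((k : ℝ) + 1)}).toReal = (μ (hZ.mk Z ⁻¹' T)).toReal := by
    rw [show {a | infDist (Z a) F < 1 / ((k : ℝ) + 1)} = Z ⁻¹' T from rfl, measure_congr hE]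
  rw [h1, h2, ← measureReal_def, ← integral_indicator_one hE']
  refine integral_mono ?_ ((integrable_const (1 : ℝ)).indicator hE') fun a => ?_
  · exact Integrable.of_bound
      ((nearIndicator F k).continuous.measurable.comp hZ.measurable_mk).aestronglyMeasurable 1
      (ae_of_all _ fun a => by
        rw [Real.norm_eq_abs, abs_of_nonneg (nearIndicator_nonneg _ _ _)]
        exact nearIndicator_le_one _ _ _)
  · by_cases ha : a ∈ hZ.mk Z ⁻¹' T
    · rw [indicator_of_mem ha, Pi.one_apply]
      exact nearIndicator_le_one _ _ _
    · rw [indicator_of_notMem ha]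
      have ha' : 1 / ((k : ℝ) + 1) ≤ infDist (hZ.mk Z a) F := by
        by_contra hcon
        exact ha (not_le.1 hcon)
      exact (nearIndicator_eq_zero_of_le ha').le

variable {Ωδ : ℝ → Type*} [∀ δ, MeasurableSpace (Ωδ δ)] {Y : ∀ δ, Ωδ δ → X}
  {P : ∀ δ, Measure (Ωδ δ)} {Ω' : Type*} [MeasurableSpace Ω'] {W : Measure Ω'} {Z : Ω' → X}

/-- **Closed-set portmanteau inequality, quantitative form, along `δ → 0⁺`.** If `Y δ → Z` in
law (bounded continuous test functions; finite laws), the `Y δ` are measurable and `F` is closed,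
then for every `ε > 0`, eventually `P δ [Y δ ∈ F] ≤ W[Z ∈ F] + ε`
(`limsup P δ [Y δ ∈ F] ≤ W[Z ∈ F]`). [cite: Billingsley1999, Thm 2.1] -/
theorem eventually_measure_mem_le_add [∀ δ, IsFiniteMeasure (P δ)] [IsFiniteMeasure W]
    (hY : ∀ δ, Measurable (Y δ)) (hZ : AEMeasurable Z W) (hT : TendstoLaw Y P Z W)
    {F : Set X} (hF : IsClosed F) {ε : ℝ≥0∞} (hε : 0 < ε) :
    ∀ᶠ δ in 𝓝[>] (0 : ℝ), P δ {ω | Y δ ω ∈ F} ≤ W {ω | Z ω ∈ F} + ε := by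
  rcases eq_or_ne ε ⊤ with rfl | hεtop
  · exact Eventually.of_forall fun δ => by simp
  rcases F.eq_empty_or_nonempty with rfl | hne
  · exact Eventually.of_forall fun δ => by simp
  -- continuity from above: `W[dist(Z,F) < 1/(k+1)] ↓ W[Z ∈ F]`
  set T : ℕ → Set Ω' := fun k => {ω | infDist (Z ω) F < 1 / ((k : ℝ) + 1)} with hTdef
  have hanti : Antitone T := by
    intro m n hmn ω hω
    simp only [hTdef, mem_setOf_eq] at hω ⊢
    have : (1 : ℝ) / ((n : ℝ) + 1) ≤ 1 / ((m : ℝ) + 1) :=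
      one_div_le_one_div_of_le (by positivity) (by exact_mod_cast Nat.succ_le_succ hmn)
    linarith
  have hI : {ω | Z ω ∈ F} = ⋂ k, T k := by
    ext ω
    simp only [mem_setOf_eq, mem_iInter, hTdef]
    rw [hF.mem_iff_infDist_zero hne]
    constructor
    · intro h k; rw [h]; positivity
    · intro h
      refine le_antisymm (le_of_forall_pos_lt_add fun η hη => ?_) infDist_nonneg
      obtain ⟨k, hk⟩ := exists_nat_one_div_lt hη
      linarith [h k]
  have hmeas : ∀ k, NullMeasurableSet (T k) W := fun k =>
    hZ.nullMeasurableSet_preimage (isOpen_lt (continuous_infDist_pt F) continuous_const).measurableSet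
  have hlim : Tendsto (fun k => W (T k)) atTop (𝓝 (W {ω | Z ω ∈ F})) := by
    rw [hI]; exact tendsto_measure_iInter_atTop hmeas hanti ⟨0, measure_ne_top _ _⟩
  have hε2 : 0 < ε / 2 := ENNReal.half_pos hε.ne'
  have hε2top : ε / 2 ≠ ⊤ := ENNReal.div_ne_top hεtop two_ne_zero
  have hlt : W {ω | Z ω ∈ F} < W {ω | Z ω ∈ F} + ε / 2 :=
    ENNReal.lt_add_right (measure_ne_top _ _) hε2.ne'
  obtain ⟨k, hk⟩ := (hlim.eventually (Iio_mem_nhds hlt)).exists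
  -- convergence of the test integrals
  set L : ℝ := ∫ ω, nearIndicator F k (Z ω) ∂W with hL
  have hconv : Tendsto (fun δ => ∫ ω, nearIndicator F k (Y δ ω) ∂P δ) (𝓝[>] (0 : ℝ)) (𝓝 L) :=
    hT (nearIndicator F k)
  have hLlt : L < L + (ε / 2).toReal := lt_add_of_pos_right L (ENNReal.toReal_pos hε2.ne' hε2top)
  filter_upwards [hconv.eventually (Iio_mem_nhds hLlt)] with δ hδ
  have h1 : (P δ {ω | Y δ ω ∈ F}).toReal ≤ ∫ ω, nearIndicator F k (Y δ ω) ∂P δ :=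
    measureReal_mem_le_integral_nearIndicator (P δ) (hY δ) hF k
  have h2 : L ≤ (W (T k)).toReal := integral_nearIndicator_le_measureReal W hZ F k
  have h3 : (W (T k)).toReal ≤ (W {ω | Z ω ∈ F} + ε / 2).toReal :=
    ENNReal.toReal_mono (ENNReal.add_ne_top.2 ⟨measure_ne_top _ _, hε2top⟩) hk.le
  have h4 : (P δ {ω | Y δ ω ∈ F}).toReal ≤ (W {ω | Z ω ∈ F} + ε / 2).toReal + (ε / 2).toReal := by
    have := hδ.le
    linarith
  calc P δ {ω | Y δ ω ∈ F} = ENNReal.ofReal (P δ {ω | Y δ ω ∈ F}).toReal :=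
        (ENNReal.ofReal_toReal (measure_ne_top _ _)).symm
    _ ≤ ENNReal.ofReal ((W {ω | Z ω ∈ F} + ε / 2).toReal + (ε / 2).toReal) := ENNReal.ofReal_le_ofReal h4
    _ = W {ω | Z ω ∈ F} + ε / 2 + ε / 2 := by
        rw [ENNReal.ofReal_add ENNReal.toReal_nonneg ENNReal.toReal_nonneg,
          ENNReal.ofReal_toReal (ENNReal.add_ne_top.2 ⟨measure_ne_top _ _, hε2top⟩),
          ENNReal.ofReal_toReal hε2top]
    _ = W {ω | Z ω ∈ F} + ε := by rw [add_assoc, ENNReal.add_halves]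

end Portmanteau

/-! ### Lattice side: a walk with `n + 1` sites has a `δ`-tube of area `≥ (n+1) δ²` -/

section Squares

variable {Ω : Set ℂ} {δ : ℝ} {a b : Site 2}

/-- The open axis-parallel square of side `δ` centred at the mesh point of `v`. [folklore] -/
def meshSquare (δ : ℝ) (v : Site 2) : Set ℂ :=
  Complex.measurableEquivRealProd ⁻¹'
    (Ioo (δ * v 0 - δ / 2) (δ * v 0 + δ / 2) ×ˢ Ioo (δ * v 1 - δ / 2) (δ * v 1 + δ / 2))

/-- Membership in a mesh square, in coordinates. [folklore] -/
theorem mem_meshSquare_iff {z : ℂ} {v : Site 2} :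
    z ∈ meshSquare δ v ↔ (δ * v 0 - δ / 2 < z.re ∧ z.re < δ * v 0 + δ / 2) ∧
      (δ * v 1 - δ / 2 < z.im ∧ z.im < δ * v 1 + δ / 2) := by
  simp [meshSquare, Complex.measurableEquivRealProd_apply, mem_prod, mem_Ioo]

/-- Mesh squares are measurable. [folklore] -/
theorem measurableSet_meshSquare (δ : ℝ) (v : Site 2) : MeasurableSet (meshSquare δ v) :=
  Complex.measurableEquivRealProd.measurable (measurableSet_Ioo.prod measurableSet_Ioo)

/-- A mesh square has area `δ²` (`δ > 0`). [folklore] -/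
theorem volume_meshSquare (hδ : 0 < δ) (v : Site 2) : volume (meshSquare δ v) = ENNReal.ofReal (δ ^ 2) := by
  rw [meshSquare, Complex.volume_preserving_equiv_real_prod.measure_preimage
    (measurableSet_Ioo.prod measurableSet_Ioo).nullMeasurableSet,
    Measure.volume_eq_prod, Measure.prod_prod, Real.volume_Ioo, Real.volume_Ioo,
    ← ENNReal.ofReal_mul (by linarith), sq]
  congr 1
  ring

/-- Two integers whose `δ`-cells `(δp - δ/2, δp + δ/2)` share a point are equal (`δ > 0`).
[folklore] -/
theorem int_eq_of_mem_cells (hδ : 0 < δ) {p q : ℤ} {t : ℝ}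
    (hp : δ * p - δ / 2 < t ∧ t < δ * p + δ / 2) (hq : δ * q - δ / 2 < t ∧ t < δ * q + δ / 2) :
    p = q := by
  have hlt1 : ((p : ℝ) - q) < 1 := by
    by_contra hcon
    push Not at hcon
    have : δ * 1 ≤ δ * ((p : ℝ) - q) := mul_le_mul_of_nonneg_left hcon hδ.le
    nlinarith [hp.1, hq.2]
  have hlt2 : ((q : ℝ) - p) < 1 := by
    by_contra hcon
    push Not at hcon
    have : δ * 1 ≤ δ * ((q : ℝ) - p) := mul_le_mul_of_nonneg_left hcon hδ.le
    nlinarith [hp.2, hq.1]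
  have h3 : ((p - q : ℤ) : ℝ) < 1 := by push_cast; exact hlt1
  have h4 : ((q - p : ℤ) : ℝ) < 1 := by push_cast; exact hlt2
  have h5 : p - q < 1 := by exact_mod_cast h3
  have h6 : q - p < 1 := by exact_mod_cast h4
  omega

/-- Mesh squares of distinct sites are disjoint (`δ > 0`). [folklore] -/
theorem disjoint_meshSquare (hδ : 0 < δ) {v w : Site 2} (hvw : v ≠ w) :
    Disjoint (meshSquare δ v) (meshSquare δ w) := by
  rw [Set.disjoint_left]
  intro z hzv hzw
  rw [mem_meshSquare_iff] at hzv hzw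
  apply hvw
  funext i
  fin_cases i
  · exact int_eq_of_mem_cells hδ hzv.1 hzw.1
  · exact int_eq_of_mem_cells hδ hzv.2 hzw.2

/-- A mesh square lies within distance `δ` of its centre: it is contained in the closed
`δ`-tube of any set containing the mesh point. [folklore] -/
theorem meshSquare_subset_setOf_infDist_le {v : Site 2} {K : Set ℂ}
    (hv : meshPoint δ v ∈ K) : meshSquare δ v ⊆ {w : ℂ | infDist w K ≤ δ} := by
  intro z hz
  rw [mem_meshSquare_iff] at hz
  rw [mem_setOf_eq]
  refine (infDist_le_dist_of_mem hv).trans ?_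
  rw [Complex.dist_eq]
  refine (Complex.norm_le_abs_re_add_abs_im _).trans ?_
  rw [Complex.sub_re, Complex.sub_im, meshPoint_re, meshPoint_im]
  have h1 : |z.re - δ * v 0| ≤ δ / 2 := abs_le.2 ⟨by linarith [hz.1.1], by linarith [hz.1.2]⟩
  have h2 : |z.im - δ * v 1| ≤ δ / 2 := abs_le.2 ⟨by linarith [hz.2.1], by linarith [hz.2.2]⟩
  linarith

/-- **A self-avoiding walk of `Ω_δ` with `|γ| + 1` sites has a closed `δ`-tube of area
`≥ (|γ|+1) δ²`**: the mesh squares around its (distinct) sites are pairwise disjoint and lie in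
the tube, the sites being on the polyline. [folklore] -/
theorem card_mul_sq_le_volume_ctube (hδ : 0 < δ) (γ : DomainSAW Ω δ a b) :
    ((γ.length + 1 : ℕ) : ℝ≥0∞) * ENNReal.ofReal (δ ^ 2)
      ≤ volume {w : ℂ | infDist w γ.curve.range ≤ δ} := by
  classical
  set T : Finset (Site 2) := γ.walk.support.toFinset with hT
  have hcard : T.card = γ.length + 1 := by
    rw [hT, List.toFinset_card_of_nodup γ.isPath.support_nodup, SimpleGraph.Walk.length_support]
    rfl
  have hdisj : (T : Set (Site 2)).PairwiseDisjoint (meshSquare δ) :=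
    fun v _ w _ hvw => disjoint_meshSquare hδ hvw
  have hU : volume (⋃ v ∈ T, meshSquare δ v) = ∑ v ∈ T, volume (meshSquare δ v) :=
    measure_biUnion_finset hdisj fun v _ => measurableSet_meshSquare δ v
  have hsub : (⋃ v ∈ T, meshSquare δ v) ⊆ {w : ℂ | infDist w γ.curve.range ≤ δ} := by
    intro z hz
    simp only [mem_iUnion, exists_prop] at hz
    obtain ⟨v, hvT, hzv⟩ := hz
    have hv : v ∈ γ.walk.support := by rw [hT, List.mem_toFinset] at hvT; exact hvT
    exact meshSquare_subset_setOf_infDist_le (meshPoint_mem_range_curve γ hv) hzv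
  calc ((γ.length + 1 : ℕ) : ℝ≥0∞) * ENNReal.ofReal (δ ^ 2)
      = ∑ v ∈ T, volume (meshSquare δ v) := by
        rw [Finset.sum_congr rfl fun v _ => volume_meshSquare hδ v, Finset.sum_const, hcard,
          nsmul_eq_mul]
    _ = volume (⋃ v ∈ T, meshSquare δ v) := hU.symm
    _ ≤ volume {w : ℂ | infDist w γ.curve.range ≤ δ} := measure_mono hsub

end Squares

/-! ### The SLE side: the image curve of SLE_κ, `κ ≤ 4`, has zero area -/

section SLEArea

open UpperHalfPlane (upperHalfPlaneSet isOpen_upperHalfPlaneSet)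

/-- A holomorphic map on an open set does not increase Hausdorff dimension (it is locally
Lipschitz), so it maps subsets of dimension `< 2` to Lebesgue-null sets. [folklore] -/
theorem volume_image_eq_zero_of_differentiableOn {U : Set ℂ} (hU : IsOpen U) {f : ℂ → ℂ}
    (hf : DifferentiableOn ℂ f U) {S : Set ℂ} (hS : S ⊆ U) (hdim : dimH S < 2) :
    volume (f '' S) = 0 := by
  refine volume_eq_zero_of_dimH_lt_two (lt_of_le_of_lt ?_ hdim)
  refine dimH_image_le_of_locally_lipschitzOn fun x hx => ?_
  have hcd : ContDiffAt ℂ 1 f x := (hf.contDiffOn hU).contDiffAt (hU.mem_nhds (hS hx))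
  obtain ⟨K, t, ht, hK⟩ := hcd.exists_lipschitzOnWith
  exact ⟨K, t, mem_nhdsWithin_of_mem_nhds ht, hK⟩

/-- `1 + κ/8 < 2` in `ℝ≥0∞` for `κ < 8`. [folklore] -/
theorem one_add_div_eight_lt_two {κ : ℝ≥0} (hκ8 : κ < 8) : (1 : ℝ≥0∞) + (κ : ℝ≥0∞) / 8 < 2 := by
  have h1 : (κ : ℝ≥0∞) / 8 < 1 := by
    rw [ENNReal.div_lt_iff (Or.inl (by norm_num)) (Or.inl (by norm_num)), one_mul]
    exact_mod_cast hκ8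
  calc (1 : ℝ≥0∞) + (κ : ℝ≥0∞) / 8 < 1 + 1 := ENNReal.add_lt_add_left ENNReal.one_ne_top h1
    _ = 2 := one_add_one_eq_two

variable {κ : ℝ≥0} {D : DobrushinDomain} {Γ : (ℝ≥0 → ℝ) → CurveClass ℂ}

/-- **The trace of a chordal SLE_κ random curve, `0 < κ ≤ 4`, has zero area almost surely.**
Its range is contained in `φ(γ[0,∞) ∩ ℍ) ∪ {Φ(γ(0)), b}` for the uniformizing map `φ` (the
half-plane trace is simple and stays in `ℍ` for `t > 0`, Rohde–Schramm Thm 6.1, proved in the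
tree), `dim_H γ[0,∞) ≤ 1 + κ/8 < 2` (Rohde–Schramm Thm 8.1 / Cor. 8.2, proved in the tree from the
one-point estimate) and `φ` is holomorphic on `ℍ`. [cite: RohdeSchramm2005, Thm 8.1] -/
theorem ae_volume_range_eq_zero_of_isSLECurve (hκ0 : 0 < κ) (hκ4 : κ ≤ 4)
    (hΓ : IsSLECurve κ D Γ) :
    ∀ᵐ ω ∂Literature.Probability.Process.preWienerMeasure, volume (Γ ω).range = 0 := by
  have hκ8 : κ < 8 := hκ4.trans_lt (by norm_num)
  have hdim := ae_dimH_range_sleTrace_le hκ0 hκ8 hΓ.hasSLETrace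
  have hsimple := ae_isSimpleTrace_sleTrace_of_le_four_holds hκ0 hκ4
  obtain ⟨-, φ, -, hae⟩ := hΓ
  filter_upwards [hae, hdim, hsimple] with ω hω hdimω hsω
  obtain ⟨-, c, hc, himg⟩ := hω
  rw [hc, CurveClass.range_mk]
  set tr : ℝ≥0 → ℂ := sleTrace κ ω with htr
  have hsub : c.range ⊆ φ '' (range tr ∩ upperHalfPlaneSet) ∪
      {φ.boundaryExtension (tr 0), D.pt 1} := by
    rintro z ⟨s, rfl⟩
    by_cases hs : (s : ℝ) < 1
    · rw [himg.1 s hs]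
      rcases eq_or_ne (rayParam s) 0 with h0 | h0
      · right
        rw [h0]
        exact mem_insert _ _
      · left
        have him : 0 < (tr (rayParam s)).im := hsω.2 _ (pos_iff_ne_zero.2 h0)
        have hmem : tr (rayParam s) ∈ upperHalfPlaneSet := him
        exact ⟨tr (rayParam s), ⟨⟨rayParam s, rfl⟩, hmem⟩, (φ.boundaryExtension_eq hmem).symm⟩
    · have hs1 : s = 1 := Subtype.ext (le_antisymm s.2.2 (not_lt.1 hs))
      right
      rw [hs1, himg.2]
      exact mem_insert_of_mem _ (mem_singleton _)
  have hvol1 : volume (φ '' (range tr ∩ upperHalfPlaneSet)) = 0 :=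
    volume_image_eq_zero_of_differentiableOn isOpen_upperHalfPlaneSet φ.differentiableOn_coe
      inter_subset_right
      ((dimH_mono inter_subset_left).trans_lt (hdimω.trans_lt (one_add_div_eight_lt_two hκ8)))
  have hvol2 : volume ({φ.boundaryExtension (tr 0), D.pt 1} : Set ℂ) = 0 :=
    volume_eq_zero_of_dimH_lt_two (by rw [(Set.toFinite _).dimH_zero]; norm_num)
  exact measure_mono_null hsub (measure_union_null hvol1 hvol2)

end SLEArea

/-! ### Zero density of the lattice walk from an SLE_κ limit, `κ ≤ 4` -/

section Necessity

variable {κ : ℝ≥0} {D : DobrushinDomain} {A B : ℝ → Site 2}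

/-- **An SLE_κ limit (`0 < κ ≤ 4`) forces zero density.** If the polylines of a family of random
self-avoiding walks of `Ω_δ` (finite laws `P δ`) converge in law, in the curve topology, to a
chordal SLE_κ random curve with `κ ≤ 4`, then `P δ [δ²|γ_δ| ≥ ρ] → 0` for every `ρ > 0`: the
closed-tube volume `c ↦ vol{w : dist(w, trace c) ≤ η}` is upper semicontinuous, `≥ (|γ_δ|+1)δ²`
on a walk with mesh `δ ≤ η` (disjoint mesh squares), and `↓ vol(trace) = 0` a.s. at the limit;
closed-set portmanteau. [cite: Billingsley1999, Thm 2.1] -/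
theorem tendsto_measure_density_of_convergesInLawToSLE
    {P : ∀ δ : ℝ, Measure (DomainSAW D.carrier δ (A δ) (B δ))} [∀ δ, IsFiniteMeasure (P δ)]
    (hκ0 : 0 < κ) (hκ4 : κ ≤ 4)
    (h : ConvergesInLawToSLE κ D (fun δ (γ : DomainSAW D.carrier δ (A δ) (B δ)) => γ.curve) P)
    {ρ : ℝ} (hρ : 0 < ρ) :
    Tendsto (fun δ => P δ {γ | ρ ≤ δ ^ 2 * γ.length}) (𝓝[>] 0) (𝓝 0) := by
  obtain ⟨Γ, hΓ, -, hT⟩ := h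
  haveI : IsProbabilityMeasure Literature.Probability.Process.preWienerMeasure :=
    Literature.Probability.Process.isProbabilityMeasure_preWienerMeasure
      isProjectiveLimit_preWienerMeasure_holds
  have hzero := ae_volume_range_eq_zero_of_isSLECurve hκ0 hκ4 hΓ
  set W : Measure (ℝ≥0 → ℝ) := Literature.Probability.Process.preWienerMeasure with hW
  rw [ENNReal.tendsto_nhds_zero]
  intro ε hε
  have hε2 : 0 < ε / 2 := ENNReal.half_pos hε.ne'
  set M : ℝ≥0∞ := ENNReal.ofReal ρ with hM_def
  have hM : 0 < M := ENNReal.ofReal_pos.2 hρ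
  -- the decreasing events `E n = {M ≤ vol(closed 1/(n+1)-tube of the limit)}`
  set E : ℕ → Set (ℝ≥0 → ℝ) := fun n =>
    {ω | M ≤ volume {w : ℂ | infDist w (Γ ω).range ≤ 1 / ((n : ℝ) + 1)}} with hE
  have hanti : Antitone E := by
    intro m n hmn ω hω
    simp only [hE, mem_setOf_eq] at hω ⊢
    refine hω.trans (measure_mono fun w hw => ?_)
    simp only [mem_setOf_eq] at hw ⊢
    have : (1 : ℝ) / ((n : ℝ) + 1) ≤ 1 / ((m : ℝ) + 1) :=
      one_div_le_one_div_of_le (by positivity) (by exact_mod_cast Nat.succ_le_succ hmn)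
    linarith
  have hinter : W (⋂ n, E n) = 0 := by
    have hnull : W {ω | ¬ volume (Γ ω).range = 0} = 0 := ae_iff.1 hzero
    refine measure_mono_null (fun ω hω => ?_) hnull
    simp only [mem_iInter, hE, mem_setOf_eq] at hω
    simp only [mem_setOf_eq]
    intro h0
    have hle : M ≤ volume (Γ ω).range :=
      ge_of_tendsto' (tendsto_volume_ctube_nat (Γ ω)) hω
    rw [h0] at hle
    exact hM.ne' (le_antisymm hle bot_le)
  have hmeasE : ∀ n, NullMeasurableSet (E n) W := fun n =>
    hΓ.1.nullMeasurableSet_preimage (isClosed_setOf_le_volume_ctube _ M).measurableSet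
  have hlim : Tendsto (fun n => W (E n)) atTop (𝓝 (W (⋂ n, E n))) :=
    tendsto_measure_iInter_atTop hmeasE hanti ⟨0, measure_ne_top _ _⟩
  rw [hinter] at hlim
  obtain ⟨n, hn⟩ := (hlim.eventually (Iio_mem_nhds hε2)).exists
  -- closed-set portmanteau for `F = {M ≤ vol(closed η-tube)}`, `η = 1/(n+1)`
  set η : ℝ := 1 / ((n : ℝ) + 1) with hη
  have hηpos : 0 < η := by rw [hη]; positivity
  have hF := isClosed_setOf_le_volume_ctube η M
  have hport := eventually_measure_mem_le_add (X := CurveClass ℂ)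
    (Y := fun δ (γ : DomainSAW D.carrier δ (A δ) (B δ)) => γ.curve) (P := P)
    (fun δ => DomainSAW.measurable_of_top _) hΓ.1 hT hF hε2
  have hsmall : ∀ᶠ δ in 𝓝[>] (0 : ℝ), 0 < δ ∧ δ < η := by
    filter_upwards [self_mem_nhdsWithin, (eventually_lt_nhds hηpos).filter_mono nhdsWithin_le_nhds]
      with δ hδ hδη
    exact ⟨hδ, hδη⟩
  filter_upwards [hport, hsmall] with δ hδp hδs
  obtain ⟨hδ, hδη⟩ := hδs
  have hsub : {γ : DomainSAW D.carrier δ (A δ) (B δ) | ρ ≤ δ ^ 2 * γ.length} ⊆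
      {γ | γ.curve ∈ {c : CurveClass ℂ | M ≤ volume {w : ℂ | infDist w c.range ≤ η}}} := by
    intro γ hγ
    simp only [mem_setOf_eq] at hγ ⊢
    calc M ≤ ENNReal.ofReal (δ ^ 2 * γ.length) := ENNReal.ofReal_le_ofReal hγ
      _ = (γ.length : ℝ≥0∞) * ENNReal.ofReal (δ ^ 2) := by
          rw [mul_comm, ENNReal.ofReal_mul (Nat.cast_nonneg _), ENNReal.ofReal_natCast]
      _ ≤ ((γ.length + 1 : ℕ) : ℝ≥0∞) * ENNReal.ofReal (δ ^ 2) := by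
          gcongr
          exact_mod_cast Nat.le_succ _
      _ ≤ volume {w : ℂ | infDist w γ.curve.range ≤ δ} := card_mul_sq_le_volume_ctube hδ γ
      _ ≤ volume {w : ℂ | infDist w γ.curve.range ≤ η} :=
          measure_mono fun w hw => le_trans (by exact hw) hδη.le
  calc P δ {γ | ρ ≤ δ ^ 2 * γ.length}
      ≤ P δ {γ | γ.curve ∈ {c : CurveClass ℂ | M ≤ volume {w : ℂ | infDist w c.range ≤ η}}} :=
        measure_mono hsub
    _ ≤ W (E n) + ε / 2 := hδp
    _ ≤ ε / 2 + ε / 2 := add_le_add hn.le le_rfl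
    _ = ε := ENNReal.add_halves ε

/-- The critical SAW law is a finite measure (it is `lawAt x_c`). [folklore] -/
instance isFiniteMeasure_law (Ω : Set ℂ) (δ : ℝ) (a b : Site 2) : IsFiniteMeasure (law Ω δ a b) := by
  rw [← lawAt_criticalFugacity]; infer_instance

/-- `8/3 ≤ 4` in `ℝ≥0`. [folklore] -/
theorem eight_thirds_le_four : (8 : ℝ≥0) / 3 ≤ 4 := by
  rw [div_le_iff₀ (by norm_num : (0 : ℝ≥0) < 3)]
  norm_num

/-- **`SAWScalingLimit` (the SLE_{8/3} identification) implies zero density of the critical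
self-avoiding walk** in every
Dobrushin domain with an endpoint approximation: under `SAWScalingLimit`,
`P_{(Ω_δ,a_δ,b_δ,x_c)}[δ²|γ_δ| ≥ ρ] → 0` for every `ρ > 0` — the necessity clause recorded in
prose in `SupercriticalSAWSpaceFillingDensity`. [cite: LawlerSchrammWerner2004SAW, §3.4.2 and Prediction 1 (§4.1)] -/
theorem tendsto_law_density_of_sawScalingLimit (h : SAWScalingLimit) (D : DobrushinDomain)
    (A B : ℝ → Site 2) (hAB : IsEndpointApprox D A B) {ρ : ℝ} (hρ : 0 < ρ) :
    Tendsto (fun δ => law D.carrier δ (A δ) (B δ) {γ | ρ ≤ δ ^ 2 * γ.length}) (𝓝[>] 0) (𝓝 0) :=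
  tendsto_measure_density_of_convergesInLawToSLE (κ := (8 : ℝ≥0) / 3) (by positivity)
    eight_thirds_le_four (h D A B hAB) hρ

/-- The unit-disc instance in the notation of `SupercriticalSAWSpaceFillingDensity`: under
`SAWScalingLimit`, for every endpoint approximation of `(𝔻; 1, -1)` the zero-critical-density
conclusion (Z) of that file holds. [cite: LawlerSchrammWerner2004SAW, §3.4.2 and Prediction 1 (§4.1)] -/
theorem tendsto_lawAt_density_unitDisc_of_sawScalingLimit (h : SAWScalingLimit)
    (hAB : IsEndpointApprox DobrushinDomain.unitDisc A B) {ρ : ℝ} (hρ : 0 < ρ) :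
    Tendsto (fun δ => lawAt criticalFugacity unitDisk δ (A δ) (B δ) {γ | ρ ≤ δ ^ 2 * γ.length})
      (𝓝[>] 0) (𝓝 0) :=
  tendsto_law_density_of_sawScalingLimit h DobrushinDomain.unitDisc A B hAB hρ

end Necessity

end SupercriticalSAW

open SupercriticalSAW

/-- **Barrier `SupercriticalSAWSpaceFilling`, density axis, part B: zero critical density is a
NECESSARY condition of the sub-problem.** `SAWScalingLimit` implies, for every Dobrushin domain
`D`, every endpoint approximation `(A, B)` and every `ρ > 0`,
`P_{(Ω_δ,a_δ,b_δ,x_c)}[δ²|γ_δ| ≥ ρ] → 0` as `δ → 0⁺` — the conclusion (Z) of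
`SupercriticalSAWSpaceFillingDensity`, there reached from the supercritical side (right-continuity
of Problem 9's density `θ(x)` at `x_c`), is here shown to be forced by the SLE_{8/3} statement
`SAWScalingLimit` itself, so the density axis of the tenth audit connects a SUPERCRITICAL counting statement to a
genuine NECESSARY condition of the summit conjunct.

BARRIER (structured block, D-0021):
- technique_class: none obstructed — this entry is the necessity half of evasion (xiv) of the parent entry (density / free-energy axis): any candidate limit in law of the critical SAW polylines, in the curve topology, that is carried by curves of zero area (every chordal SLE_κ, `0 < κ ≤ 4`, `SupercriticalSAW.ae_volume_range_eq_zero_of_isSLECurve` [cite: RohdeSchramm2005, Thm 8.1]) forces `δ²|γ_δ| → 0` in probability (`SupercriticalSAW.tendsto_measure_density_of_convergesInLawToSLE`) [cite: LawlerSchrammWerner2004SAW, §3.4.2 and Prediction 1 (§4.1)]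
- blocks: contrapositively, positive density of the critical walk with non-vanishing probability along a subsequence (`limsup P_{x_c}[δ²|γ_δ| ≥ ρ] > 0` for some `ρ > 0`) refutes `SAWScalingLimit` and every SLE_κ identification with `κ ≤ 4`; by part A, such a scenario requires a corner of the free energy at `x_c` (`θ(x_c⁺) > 0`, a first-order dilute/dense transition) [cite: DuminilCopinKozmaYadin2014, §4 (Problem 9)]
- because: disjoint mesh squares give `(|γ_δ|+1)δ² ≤ vol(closed δ-tube of the polyline)` (`SupercriticalSAW.card_mul_sq_le_volume_ctube`); the closed-tube volume is upper semicontinuous on curve classes (`SupercriticalSAW.upperSemicontinuous_volume_ctube`) and decreases to the area of the trace (`SupercriticalSAW.tendsto_volume_ctube_nat`); the quantitative closed-set portmanteau inequality (`SupercriticalSAW.eventually_measure_mem_le_add`) [cite: Billingsley1999, Thm 2.1]; and the SLE_κ image curve has zero area for `κ ≤ 4` — simple trace in `ℍ ∪ {0}` [cite: RohdeSchramm2005, Thm 6.1], `dim_H ≤ 1 + κ/8 < 2` [cite: RohdeSchramm2005, Thm 8.1], holomorphic (locally Lipschitz) uniformizing map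
- evasions_known: not applicable (a necessity theorem); for `4 < κ < 8` the same conclusion holds in substance (the trace still has dimension `1 + κ/8 < 2`) but the boundary part `Φ(γ ∩ ℝ) ⊆ ∂D` needs `vol(∂D) = 0`, false for Osgood-type Jordan curves and not pursued; for `κ ≥ 8` the limit is onto and the density need not vanish
- scope_caveats: the statement is about the number of sites `|γ_δ| + 1` normalised by `δ⁻²` (density per unit area up to the constant `1`), in probability; it says nothing about the expected density of part A's (Θ)/(F) beyond `P`-convergence (the density is bounded by `|Ω_δ|δ² ≤ 25` in the disc, so convergence in probability and in expectation agree there — not spelled out); endpoints arbitrary (`IsEndpointApprox` is used only through `SAWScalingLimit`)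
- status: established (proved here: `SupercriticalSAWSpaceFillingDensityNecessary_holds`, axioms `propext`, `Classical.choice`, `Quot.sound`); audit gen 10 of `…Proofs` 2026-08-16, part B

[cite: LawlerSchrammWerner2004SAW, §3.4.2 and Prediction 1 (§4.1)] -/
def SupercriticalSAWSpaceFillingDensityNecessary : Prop :=
  SAWScalingLimit → ∀ (D : DobrushinDomain) (A B : ℝ → Site 2), IsEndpointApprox D A B →
    ∀ ρ : ℝ, 0 < ρ →
      Tendsto (fun δ => law D.carrier δ (A δ) (B δ) {γ | ρ ≤ δ ^ 2 * γ.length}) (𝓝[>] 0) (𝓝 0)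

/-- The necessity clause holds (proved above). [cite: LawlerSchrammWerner2004SAW, §3.4.2 and Prediction 1 (§4.1)] -/
theorem SupercriticalSAWSpaceFillingDensityNecessary_holds :
    SupercriticalSAWSpaceFillingDensityNecessary :=
  fun h D A B hAB _ hρ => tendsto_law_density_of_sawScalingLimit h D A B hAB hρ

end Literature.Barriers.CriticalPhenomena
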